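import Mathlib
import HarnessLib
import HarnessLib.Audit
import Summits.AtomisticToContinuum.Statement

/-!
Route: BECConditionalEntropy

CLOSED (retired) 2026-08-15T13:38:42Z by operator:999:1257524 — reason: not-a-thesis: assembly does not conclude the sub-problem Statement — note: D-0027 §2.1 audit (human 2026-08-15: routes that do not decide the summit are removed): the assembly concludes `Literature.MathematicalPhysics.QuantumManyBody.BoseGas.BoseEinsteinCondensation`, not the sub-problem statement; a NEW conforming route may be opened from the same idea (generated `closes . The file is kept as the record of this route; refuted decls are indexed as negative knowledge (`ledger negatives`).

# Route BECConditionalEntropy — BEC as bounded conditional entropy — one boson carries O(1) nats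
about the rest; exact two-scale KL chain rule, log-Sobolev only on cells of fixed side

X (BOUNDED CONDITIONAL ENTROPY DEFICIT; formal = item CondEntropyBound): for every repulsive
finite-range radial v there is ρ₀ > 0 such
that for 0 < ρ < ρ₀ there is C with: for all large N there is δ > 0 such that every NON-NEGATIVE
δ-near-minimiser Ψ ≥ 0 of the Dirichlet
N-body energy in the box Λ of side L = (N/ρ)^(1/3) satisfies E_Y KL( p(·|Y) ‖ u_Λ ) ≤ C, where Y =
(x₂,…,x_N) is distributed by its
marginal m(Y)dY under |Ψ|², p(·|Y) = Ψ(·,Y)²/m(Y) is the law of one boson given all the others and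
u_Λ is the uniform law on Λ; i.e. the
conditional differential entropy h(x₁ | x₂…x_N) stays within C nats of its maximum log|Λ|, uniformly
in N ("it suffices to show X").
Realises idea card renyi-entropic-delocalisation (spine; no other card). Typed junk-free as a lower
Lebesgue integral of Mathlib's
InformationTheory.klFun (t log t + 1 − t ≥ 0) against u_Λ ⊗ m(Y)dY, with N = n + 1 and X = (x, Y)
split by Matrix.vecCons exactly as in
BoseGas.occupation; positivity is encoded as in the sibling route BECPalmLandscape (Ψ.ψ X = ‖Ψ.ψ
X‖).
Lean: `∀ v : ℝ → ENNReal,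
Literature.MathematicalPhysics.QuantumManyBody.BoseGas.IsRepulsiveFiniteRange v → ∃ ρ₀ : ℝ, 0 < ρ₀ ∧
∀ ρ : ℝ, 0 < ρ → ρ < ρ₀ → ∃ C : ℝ, ∀ᶠ n : ℕ in Filter.atTop, ∃ δ : ENNReal, 0 < δ ∧ ∀ Ψ :
Literature.MathematicalPhysics.QuantumManyBody.BoseGas.TrialState (n + 1)
(Literature.MathematicalPhysics.QuantumManyBody.BoseGas.sideLength ρ (n + 1)),
Literature.MathematicalPhysics.QuantumManyBody.BoseGas.energy v Ψ ≤
Literature.MathematicalPhysics.QuantumManyBody.BoseGas.groundStateEnergy v (n + 1)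
(Literature.MathematicalPhysics.QuantumManyBody.BoseGas.sideLength ρ (n + 1)) + δ → (∀ X, Ψ.ψ X =
(‖Ψ.ψ X‖ : ℂ)) → ∫⁻ Y : Literature.MathematicalPhysics.QuantumManyBody.BoseGas.Config n, ∫⁻ x in
Literature.MathematicalPhysics.QuantumManyBody.BoseGas.box
(Literature.MathematicalPhysics.QuantumManyBody.BoseGas.sideLength ρ (n + 1)), ENNReal.ofReal ((∫ z,
‖Ψ.ψ (Matrix.vecCons z Y)‖ ^ 2) / Literature.MathematicalPhysics.QuantumManyBody.BoseGas.sideLength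
ρ (n + 1) ^ 3 * InformationTheory.klFun
(Literature.MathematicalPhysics.QuantumManyBody.BoseGas.sideLength ρ (n + 1) ^ 3 * ‖Ψ.ψ
(Matrix.vecCons x Y)‖ ^ 2 / ∫ z, ‖Ψ.ψ (Matrix.vecCons z Y)‖ ^ 2)) ≤ ENNReal.ofReal C`

## Assembly
Pure composition plus one proved theorem (sorry-free in Sketch.lean, axioms propext /
Classical.choice / Quot.sound):
fun hMI hP hC hE hT hJ hR hN => AtomisticToContinuum.BECInfraredBound.bec_of_zeroMode (hN hE hR (hJ
(hT hE (hC hMI hP)))) — MI and Profile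
give the coarse bound (CoarseFromMIProfile); the energy bound and the two-scale lemma give X
(TwoScaleReduction); X gives the zero-mode bound
for nonneg near-minimisers (EntropicZeroMode); rigidity transfers it to all near-minimisers = X_B1
(RigidityTransfersZeroMode); bec_of_zeroMode
gives the conjunct.

Rationale: WHY THIS LINE. Positivity of the ground state turns condensation into an information statement: for
Ψ ≥ 0 the EXACT identity ⟨φ₀,γ_Ψφ₀⟩/N =
E_Y exp(−D_½(p(·|Y)‖u_Λ)) (φ₀ = L^(-3/2)·1_Λ, D_½ = Rényi-½ divergence; for Jastrow states the
Penrose–Onsager/Reatto half-strength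
test-particle formula, PenroseOnsager1956, Reatto1969) with Jensen and D_½ ≤ KL gives ⟨φ₀,γφ₀⟩ ≥
e^(−C)·N for nonneg near-minimisers
(support EntropicZeroMode); phase rigidity below the finite-N gap (crux GroundStateRigidity, the
item SHARED verbatim with route
BECPalmLandscape, + support RigidityTransfersZeroMode) upgrades this to X_B1 of route
BECInfraredBound, and X_B1 ⇒ BoseEinsteinCondensation
is PROVED in the tree (AtomisticToContinuum.BECInfraredBound.bec_of_zeroMode). X is attacked by the
exact two-scale chain rule for relative
entropy (GrunewaldEtAl2009 architecture): KL(p‖u) = KL(Q_l‖ū_l) + Σ_C Q_l(C)·KL(p_C‖u_C) at a cell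
scale l FIXED independently of N — the
local term costs ≤ c₀l² × (kinetic energy per particle) by the logarithmic Sobolev inequality for
Lebesgue measure on a cube (Weissler1980
circle LSI + even reflection + tensorisation; Ledoux2001), O(1) since the energy per particle is
bounded (LSSY2005 Thm 2.2; only boundedness
is used), and the coarse term is EXACTLY I(cell_l(x₁); Y) + KL(P_l‖ū_l) ≤ I(x₁; Y) + KL(P_l‖ū_l): a
MUTUAL INFORMATION between one boson
and all the others (crux 2) plus a one-body density-profile term (crux 4). Imported areas:
information theory (KL chain rule, data
processing, de Finetti-type MI bounds GavalakisKontoyiannis2021 / DiaconisFreedman1987), functional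
inequalities (LSI), the point-process
view of |Ψ₀|² (insertion/Palm laws; ReattoChester1967's phonon Jastrow tail u ~ 1/r² predicts I ≈
a∫S(k)k⁻²d³k = O(√(ρa³)) in d = 3,
log-divergent in d = 1). Versus the existing routes: no momentum-space infrared bound
(BECInfraredBound), no energy response at precision
N/L² (BECPinning), no torus (BECPeriodicReduction), no functional integral (BECRenormGroup); versus
the sibling positivity route
BECPalmLandscape (bounded mean participation ratio E_Q[e^(D_½)] of ONE near-minimiser per δ, to be
proved by Debye-screened Mayer
expansions): same frame (positivity → X_B1, shared rigidity item) but a different functional and a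
different engine — relative ENTROPY,
whose chain rule splits scales exactly, so that the kinetic gap is paid only inside N-independent
cells and what remains is an MI bound;
this is exit (b) "positivity + genuinely three-dimensional input" left open by
Literature.Barriers.AtomisticToContinuum.KineticGapLengthScalesNarrow.

RANKED CRUXES. #0 CondEntropyBound (target) — X as in § Thesis: mean conditional relative entropy
E_Y KL(p(·|Y)‖u_Λ) ≤ C for all nonneg δ-near-minimisers (δ chosen after N), all small ρ, uniformly
in N. (why it might fail: only through its cruxes: log N growth of I(x₁;Y) (crux 2) or a density
pile-up at scale l (crux 4); fine-scale needles in near-minimisers are excluded because δ is chosen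
after N and entropy is dominated by Fisher information (LSI).) [LSSY2005, Reatto1969,
GrunewaldEtAl2009, CoverThomas2005]
#2 MutualInformationBound (crux) — the card's MI crux in cell-free form: for every repulsive
finite-range v, all small ρ, some C(v,ρ), all large N = n+1, some δ > 0 and EVERY nonneg
δ-near-minimiser Ψ (Dirichlet, L = (N/ρ)^(1/3)), the mutual information I(x₁ ; (x₂,…,x_N)) = E_Y KL(
p(·|Y) ‖ P¹ ) under |Ψ|²dX is ≤ C (P¹ = one-body law of x₁); typed ∫_Y ∫_(x∈Λ) P¹(x)·m(Y)·klFun(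
Ψ(x,Y)² / (m(Y)P¹(x)) ) ≤ C. Expected size O(√(ρa³)) (Bogoliubov/Jastrow heuristic: I ≈ ½·Var of the
insertion field ≈ a∫S(k)k⁻²d³k). "One boson's position carries O(1) nats about all the others" IS
condensation for Ψ ≥ 0. [deps: none] [difficulty: open-problem] [difficulty: open-problem] (why it
might fail: needs O(1) fluctuations of the insertion field log p(·|Y) of |Ψ₀|² — heuristically
a∫S(k)k⁻²d³k, finite for d=3 phonons S~k; fails (I ≳ ½log N) under 1-D-type rigidity (Tonks:
λ_max~√N) or an incipient solid; no rigorous control of log Ψ₀ at small ρ exists.) [Reatto1969,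
ReattoChester1967, PenroseOnsager1956, GavalakisKontoyiannis2021, DiaconisFreedman1987, Lenard1964,
Literature.Barriers.AtomisticToContinuum.PitaevskiiStringariOneDimension,
Literature.Barriers.AtomisticToContinuum.KineticGapLengthScalesNarrow]
#3 GroundStateRigidity (crux) — PHASE RIGIDITY BELOW THE FINITE-N GAP, verbatim the signature of
item stmt-AtomisticToContinuum-3298 of route BECPalmLandscape (shared by design: one item, wanted by
both positivity routes): for every repulsive finite-range v, all small ρ, all large N and every η >
0 there is δ > 0 such that any two δ-near-minimisers Ψ, Φ of the Dirichlet energy (L = (N/ρ)^(1/3))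
satisfy ∫|Ψ − cΦ|² ≤ η for some unit complex c. Content: E₀ < ∞, compact resolvent (Rellich on Λ^N),
unique positive ground state and a spectral gap at fixed N (Perron–Frobenius / positivity-improving
semigroup, ReedSimonIV1978 XIII.12, XIII.47); for hard cores via connectedness of the dilute
hard-sphere configuration space. Here it is used only through support RigidityTransfersZeroMode.
[deps: none] [difficulty: M] [difficulty: M] (why it might fail: hard cores v=⊤ are admissible: if
the N-sphere configuration space in Λ_L is disconnected mod permutations, or two components tie in
energy, the Dirichlet ground space is degenerate and no δ pins the phase; Rellich/Perron–Frobenius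
for H_N are not in Mathlib.) [ReedSimonIV1978, LSSY2005, doi:10.1093/imrn/rnt012,
route-AtomisticToContinuum-BECPalmLandscape]
#4 ProfileEntropyBound (crux) — NO PILE-UP AT A FIXED SCALE: for every repulsive finite-range v and
all small ρ there are a cell side l > 0 and C such that for all large N = n+1, some δ > 0 and every
nonneg δ-near-minimiser Ψ, the one-body cell law P_l (cells = the ⌈L/l⌉³ congruent half-open
sub-cubes of [0,L)³, P_l(k) = P(x₁ ∈ cell k)) has KL(P_l ‖ uniform) ≤ C; typed Σ_k
M⁻³·klFun(M³P_l(k)) ≤ C, M = ⌈L/l⌉. Expected proof: Lieb–Yngvason cell method (Neumann box lower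
bound, LSSY2005 Thm 2.4 / (2.41)–(2.52); in-tree LSSY2005_boxLowerBound_holds) per cell against a
global upper bound gives Σ_k n_k²/|cell| ≤ K'ρN, i.e. χ²(P_l‖ū) = O(1) ≥ KL, for l ≥ a·Y^(-6/17);
the Dirichlet wall layer only depletes. [deps: none] [difficulty: M] [difficulty: M] (why it might
fail: stated for all nonneg δ-near-minimisers in the Dirichlet box (N/ρ)^(1/3): KL(P_l‖ū) ≤ log(sup
ρ¹/ρ) grows only under a density pile-up (wall/corner enhancement on a non-vanishing volume
fraction); the LY cell superadditivity needs l ≥ aY^(-6/17) and per-cell n_k bookkeeping uniform in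
N.) [LiebYngvason1998, LSSY2005,
Literature.MathematicalPhysics.QuantumManyBody.BoseGas.LSSY2005_boxLowerBound,
Literature.MathematicalPhysics.QuantumManyBody.BoseGas.LSSY2005_lowerBound_dirichlet]
#9 CoarseFromMIProfile (support) — MutualInformationBound → ProfileEntropyBound → (coarse
conditional entropy bound at scale l: E_Y KL(Q_l(·|Y) ‖ ū_l) ≤ C, Q_l(k|Y) = P(x₁ ∈ cell k | Y),
typed ∫_Y Σ_k m(Y)M⁻³klFun(M³A_k(Y)/m(Y))). Exact identity E_Y KL(Q_l(·|Y)‖ū_l) = I(cell_l(x₁);Y) +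
KL(P_l‖ū_l) and data processing I(cell_l(x₁);Y) ≤ I(x₁;Y) (log-sum / Jensen for klFun); constants
add, δ := min, ρ₀ := min. [deps: MutualInformationBound, ProfileEntropyBound] [difficulty:
provable-now; Lean: Fubini on Config n × Λ, finite sums, log-sum inequality] [difficulty:
provable-now] [CoverThomas2005, GrunewaldEtAl2009]
#9 TwoScaleReduction (support) — EnergyPerParticleBound → (coarse bound at scale l) →
CondEntropyBound. Exact KL chain rule over the cell partition, KL(p‖u) = KL(Q_l‖ū_l) + Σ_k
Q_l(k)KL(p_k‖u_k); local term Σ_k Q_l(k)KL(p_k‖u_k) ≤ c₀(L/M)²∫_Λ|∇_x√p|²dx with √p = Ψ(·,Y)/√m(Y)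
(Ψ ≥ 0 is C¹; no square root of Ψ is taken) by the logarithmic Sobolev inequality for Lebesgue
measure on a cube of side s with constant c₀s² (Weissler1980 circle LSI + even reflection +
tensorisation); its E_Y is c₀(L/M)² × (kinetic energy of particle 1) = c₀(L/M)²·T(Ψ)/N ≤ c₀l²(K +
δ/N) by Bose symmetry and T ≤ energy ≤ E₀ + δ ≤ KN + δ. [deps: EnergyPerParticleBound] [difficulty:
L in Lean (cube LSI is not in Mathlib); a theorem mathematically] [difficulty: L] [Weissler1980,
Ledoux2001, GrunewaldEtAl2009, LSSY2005]
#9 EntropicZeroMode (support) — CondEntropyBound → (zero-mode occupation ≥ cN for NONNEG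
near-minimisers). The Rényi-½ identity: for Ψ ≥ 0, ⟨φ₀,γ_Ψφ₀⟩/N = L⁻³∫(∫Ψ(x,Y)dx)²dY = E_Y
exp(−D_½(p(·|Y)‖u_Λ)); Jensen (m(Y)dY is a probability law) and D_½ ≤ KL (= ∫u·klFun(p/u) here) give
⟨φ₀,γφ₀⟩ ≥ exp(−C)·N; index shift N = n+1 under ∀ᶠ. Same algebra as
BECPalmLandscape.FlatModeFromLandscape with log in place of Cauchy–Schwarz. [deps: CondEntropyBound]
[difficulty: provable-now (Jensen for −log on a probability density over Config n; occupation
unfolds by definition)] [difficulty: provable-now] [Reatto1969, PenroseOnsager1956, LSSY2005,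
CoverThomas2005]
#9 RigidityTransfersZeroMode (support) — EnergyPerParticleBound → GroundStateRigidity → (zero-mode
bound for nonneg near-minimisers) → X_B1 (conclusion = BECInfraredBound.BecZeroModeThesis verbatim,
rfl-checked in Sketch.lean, so that bec_of_zeroMode applies). Proof: E₀ ≤ KN < ∞ gives, for every δ,
a near-minimiser, and diamagnetic smoothing f_ε = √(|Ψ|²+ε²) − ε (C¹, vanishes off Λ^N, symmetric,
|∇f_ε| ≤ |∇Ψ|, f_ε ≤ |Ψ|), normalised, is a NONNEG δ-near-minimiser Φ; it has ⟨φ₀,γφ₀⟩ ≥ cN;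
rigidity with η = c/4 gives ‖Ψ − c'Φ‖₂² ≤ η for every δ-near-minimiser Ψ; √occupation is
√N-Lipschitz in L² (BECPalmLandscape.OccupationStability), so ⟨φ₀,γ_Ψφ₀⟩ ≥ cN/4. [deps:
EnergyPerParticleBound, GroundStateRigidity] [difficulty: provable-now, M in Lean (the smoothed
TrialState)] [difficulty: provable-now] [LSSY2005, ReedSimonIV1978, PenroseOnsager1956]
#9 EnergyPerParticleBound (support) — energy per particle bounded in the thermodynamic limit at
small density: for every repulsive finite-range v (range R₀) there is ρ₀ > 0 (any ρ₀ < (8R₀³)⁻¹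
works) such that for 0 < ρ < ρ₀ there is K with E₀(N,(N/ρ)^(1/3)) ≤ K·N for all large N. Proof:
symmetrised product of N disjointly supported C¹ bumps of radius ρ^(-1/3)/4 centred in the N
sub-cubes of side ρ^(-1/3) (pairwise support distance > R₀ ⇒ interaction 0, ⊤·0 = 0; energy = N ×
one bump ≈ 16C·ρ^(2/3)·N). Only boundedness is used downstream (the sharp 4πρa(1+o(1)) of LSSY2005
Thm 2.2 is not needed); also the E₀ < ∞ input of the rigidity transfer. [difficulty: provable-now,
pattern of TrialState.nonempty_one] [difficulty: provable-now] [LSSY2005, Dyson1957]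

TWO-LAYER PLAN. Foreseen glued splits (nothing filed now): MutualInformationBound ⇐
InsertionFieldVariance (E_Y Var_u of the log-insertion density ≤ C: a
point-process statement on |Ψ₀|²) → VarianceToMI (KL ≤ log(1+χ²)) → MutualInformationBound;
GroundStateRigidity ⇐ UniqueGappedGroundState
(Rellich + Perron–Frobenius for Dirichlet H_N; hard-sphere connectivity at small ρ) → GapPinsPhase →
GroundStateRigidity (to be coordinated
with BECPalmLandscape's tenure planner: one split, shared); ProfileEntropyBound ⇐
CellSuperadditivity (LY cell lower bound for Dirichlet
near-minimisers) → ChiSquareProfile → ProfileEntropyBound.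

KILL CRITERIA. ¬MutualInformationBound for some admissible v at arbitrarily small ρ (I(x₁;Y) ≥ c·log
N along nonneg near-minimisers) closes the route
(close --reason refuted:MutualInformationBound) and is itself news: a positive 3-D dilute ground
state with 1-D-type rigidity.
¬GroundStateRigidity (degenerate / non-positive Dirichlet ground spaces for hard cores at small ρ)
breaks this route AND BECPalmLandscape and
the X_B1 frame generally: pivot = restate every item for v finite a.e. (positivity-improving case)
or add a connectivity hypothesis — not a
close. ¬ProfileEntropyBound (wall pile-up) forces a pivot to an inner box Λ' = (εL,(1−ε)L)³ exactly
as BECInfraredBound's items 0733/0735.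
X_B1 refuted (shared with BECInfraredBound/BECRenormGroup/BECPalmLandscape) kills the frame of all
four routes. PeriodicBEC + BoundaryTransfer
or LandscapeBound + GroundStateRigidity proved elsewhere moots it.

NOT DECOMPOSED YET. The proof technology of crux 2 (how to bound insertion-field fluctuations of
|Ψ₀|² without solving the problem: convexity of
P ↦ ∫|∇√P|² + ∫VP whose unique minimiser is Ψ₀², exchangeability / de Finetti MI bounds, local
density bounds, or BECPalmLandscape's
Debye-screened cluster expansion, which would serve both routes); the spectral package behind crux
3; the LY cell bookkeeping behind
crux 4; constants (c₀ of the cube LSI; the optimal l ~ healing length (ρa)^(-1/2) where both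
two-scale terms are O(1) with sharp
constants); inner-box variants; positive temperature. All are layer-2 children, to be filed by glued
splits after a crux moves.

CHEAPEST FALSIFIER. (i) Gaussian/Bogoliubov closed form: in the Bogoliubov ground state the density
field is Gaussian and I(cell_l(x₁);Y) ≈
½·a∫_(k<1/l) S(k)k⁻²d³k·O(1) = O(√(ρa³)); a refuter recomputing this (by hand or kit) and finding
log L growth in d = 3 kills crux 2 at once
(in d = 1 it must give log L — built-in consistency check against PitaevskiiStringariOneDimension /
Lenard's √N). (ii) VMC on the
McMillan/Reatto–Chester hard-sphere Jastrow state, N = 64…512 at ρa³ = 10⁻³: is the plug-in estimate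
of I(cell(x₁);Y) flat in N? (kit;
not run by me — one-shot planning unit). (iii) v ≡ 0 sanity (by hand): p(·|Y) = φ_D² is
Y-independent ⇒ I = 0, KL(P_l‖ū) →
3∫₀¹2sin²(πt)log(2sin²(πt))dt = 3(1 − log 2) ≈ 0.92, X_B1 true with c < (8/π²)³ — consistent.

NUMBERS. Depletion scale √(ρa³) (Bogoliubov; Lee–Huang–Yang); LSSY Thm 2.2 upper bound e₀ ≤ 4πρa(1 +
C(ρa³)^(1/3)), Thm 2.4 lower bound needs
L/a > C'Y^(-6/17), Y = 4πρa³/3 (cell scale for crux 4); healing length (ρa)^(-1/2); cube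
LSI/Poincaré constants ~ s²/π²; free Dirichlet gas
constant-mode fraction (8/π²)³ ≈ 0.533 and profile KL 3(1 − log 2) ≈ 0.92; 1-D hard core λ_max ~ √N
(Lenard1964). Items at open: 10 (3 cruxes,
one of them shared).

DEFINITION REQUESTS. None filed: everything is typed over
Literature.MathematicalPhysics.QuantumManyBody.BoseGas.{TrialState, energy, groundStateEnergy,
occupation, box, sideLength, Config, IsRepulsiveFiniteRange, BoseEinsteinCondensation}, Mathlib's
InformationTheory.klFun, Matrix.vecCons,
Nat.ceil. A reusable Literature notion (conditional relative entropy / mutual information of an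
N-body density) would shorten the
statements; to be requested under Summits/AtomisticToContinuum/BoseEinsteinCondensation/Theorems
only if a third positivity route wants the
same functionals.

Novelty: Searches (2026-08-15; OpenAlex/S2/arXiv returned HTTP 429 all day, so local + zbMATH + Crossref +
galaxy): `lit frontier AtomisticToContinuum --since 2020`
(30 rows; BEC descendants arXiv:2603.20776, arXiv:2510.20493, arXiv:2602.16566 — all
kinetic-localisation/energy); `lit bridges AtomisticToContinuum --cross any`
(no entropy/information bridge); `lit search --hybrid "conditional entropy mutual information
Bose-Einstein condensation ground state positive wave function"`
(12 textbook hits only); `lit search --source zbmath "mutual information Bose condensate ground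
state"` (1: arXiv:2606.02656, phase-space information
measures of GP condensates, numerics); `… zbmath "logarithmic Sobolev inequality Bose gas
condensation"` (0); Crossref: "two-scale logarithmic Sobolev"
(doi:10.1214/07-aihp200 GrunewaldEtAl2009; Lelièvre 2009; Menz–Otto 2013), "Reatto test particle
1969" (doi:10.1103/physrev.183.334 Reatto1969,
doi:10.1103/physrev.155.88 ReattoChester1967), "information-theoretic finite de Finetti"
(doi:10.1214/21-ecp428 GavalakisKontoyiannis2021 + 3 sequels),
"relative entropy ODLRO condensate fraction Jastrow" (Girardeau 1965, König–Vogel–Zass 2025 free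
gas; nothing entropic); `lit galaxy search --star all`
×2 substring ("logarithmic Sobolev inequality Bose-Einstein condensation", "one-particle
entanglement entropy": 0/0/0 hits each) and `--star pdf --mode intelligent`
(10 physics hits; nearest Roy et al., Phys. Rev. A 97, 043625 (2018): many-body Shannon-entropy
diagnostics  [refs: 10.1214/07-aihp200, 10.1103/physrev.183.334, 10.1103/physrev.155.88, 10.1214/21-ecp428, 2603.20776, 2510.20493, 2602.16566, 2606.02656, doi:10.1214/07-aihp200, doi:10.1103/physrev.183.334, doi:10.1103/physrev.155.88, doi:10.1214/21-ecp428, GrunewaldEtAl2009, Reatto1969, ReattoChester1967, GavalakisKontoyiannis2021, LSSY2005, PenroseOnsager1956]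

Barriers (technique_class: information-inequality log-sobolev positivity two-scale): - technique_class: information-inequality log-sobolev positivity two-scale
- Literature.Barriers.AtomisticToContinuum.KineticGapLengthScales: evaded — the Poincaré/LS constant
is paid only on cells of FIXED side l (cost c₀l² × energy per particle = O(1) uniformly in N), never
on Λ_L; the coarse scale is an information bound, not a gap.
- Literature.Barriers.AtomisticToContinuum.KineticGapLengthScalesNarrow: evaded by construction —
the narrowed entry proves that every ENERGY-WINDOW criterion with window ≥ 4π²N/L² is defeated by
Galilei boosts (exists_decondensed_within_gap); here δ is chosen AFTER N (below the finite-N gap,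
made honest by the shared crux GroundStateRigidity) and the state input is positivity Ψ ≥ 0, the
entry's own exit (b); its caveat "positivity can only be an exit through genuinely three-dimensional
input" is met by crux 2, whose heuristic value a∫S(k)k⁻²dᵈk is infrared-finite exactly when d ≥ 2
and O(√(ρa³)) in d = 3.
- Literature.Barriers.AtomisticToContinuum.PitaevskiiStringariOneDimension: consistent, not evaded —
in d = 1 the same functional diverges (I(x₁;Y) ≳ ½log N for impenetrable bosons, λ_max ~ √N,
Lenard1964; entry OneDimensionalHardCore), so the mechanism is dimension-sensitive exactly through
the infrared summability the narrowed kinetic-gap entry names.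
- Literature.Barriers.AtomisticToContinuum.OneDimensionalHardCore: as above (the 1-D witness is
reproduced by the functional, not contradicted).
- Literature.Barriers.AtomisticToContinuum.Ener

History (route lifecycle, newest last):
- 2026-08-15T13:38:42Z · CLOSED retired — not-a-thesis: assembly does not conclude the sub-problem Statement (operator:999:1257524)

sub-problem: BoseEinsteinCondensation · status: closed(retired) · opened planner-plancard-AtomisticToContinuum-BoseEin-7481a7ec-0 2026-08-15T11:20:28Z · rev 0 · ledger route-AtomisticToContinuum-BECConditionalEntropy
GENERATED by the gate from the ledger (D-0016/17). Provers cite these decls: `theorem foo : Summit.AtomisticToContinuum.BoseEinsteinCondensation.Theses.BECConditionalEntropy.<Decl> := …` in Summits/AtomisticToContinuum/BoseEinsteinCondensation/Theorems/<Name>.lean.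
-/

namespace Summit.AtomisticToContinuum.BoseEinsteinCondensation.Theses.BECConditionalEntropy

open scoped BigOperators Topology Manifold Classical MeasureTheory ProbabilityTheory Matrix InnerProductSpace ComplexConjugate ContinuousMap
open Filter Set Function TopologicalSpace MeasureTheory

attribute [summit_statement] _root_.BoseEinsteinCondensation

/-- item stmt-AtomisticToContinuum-3587 · target · rank 0 · closed · moot by None · by planner
why it might fail: only through its cruxes: log N growth of I(x₁;Y) (crux 2) or a density pile-up at scale l (crux 4); fine-scale needles in near-minimisers are excluded because δ is chosen after N and entropy is dominated by Fisher information (LSI).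
sources: LSSY2005, Reatto1969, GrunewaldEtAl2009, CoverThomas2005
[target] X as in § Thesis: mean conditional relative entropy E_Y KL(p(·|Y)‖u_Λ) ≤ C for all nonneg
δ-near-minimisers (δ chosen after N), all small ρ, uniformly in N. -/
@[route_item "route-AtomisticToContinuum-BECConditionalEntropy"]
def CondEntropyBound : Prop :=
  ∀ v : ℝ → ENNReal, Literature.MathematicalPhysics.QuantumManyBody.BoseGas.IsRepulsiveFiniteRange v → ∃ ρ₀ : ℝ, 0 < ρ₀ ∧ ∀ ρ : ℝ, 0 < ρ → ρ < ρ₀ → ∃ C : ℝ, ∀ᶠ n : ℕ in Filter.atTop, ∃ δ : ENNReal, 0 < δ ∧ ∀ Ψ : Literature.MathematicalPhysics.QuantumManyBody.BoseGas.TrialState (n + 1) (Literature.MathematicalPhysics.QuantumManyBody.BoseGas.sideLength ρ (n + 1)), Literature.MathematicalPhysics.QuantumManyBody.BoseGas.energy v Ψ ≤ Literature.MathematicalPhysics.QuantumManyBody.BoseGas.groundStateEnergy v (n + 1) (Literature.MathematicalPhysics.QuantumManyBody.BoseGas.sideLength ρ (n + 1)) + δ → (∀ X, Ψ.ψ X =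 (‖Ψ.ψ X‖ : ℂ)) → ∫⁻ Y : Literature.MathematicalPhysics.QuantumManyBody.BoseGas.Config n, ∫⁻ x in Literature.MathematicalPhysics.QuantumManyBody.BoseGas.box (Literature.MathematicalPhysics.QuantumManyBody.BoseGas.sideLength ρ (n + 1)), ENNReal.ofReal ((∫ z, ‖Ψ.ψ (Matrix.vecCons z Y)‖ ^ 2) / Literature.MathematicalPhysics.QuantumManyBody.BoseGas.sideLength ρ (n + 1) ^ 3 * InformationTheory.klFun (Literature.MathematicalPhysics.QuantumManyBody.BoseGas.sideLength ρ (n + 1) ^ 3 * ‖Ψ.ψ (Matrix.vecCons x Y)‖ ^ 2 / ∫ z, ‖Ψ.ψ (Matrix.vecCons z Y)‖ ^ 2)) ≤ ENNReal.ofReal C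

/-- item stmt-AtomisticToContinuum-3594 · crux · rank 2 · closed · moot by None · by planner
why it might fail: needs O(1) fluctuations of the insertion field log p(·|Y) of |Ψ₀|² — heuristically a∫S(k)k⁻²d³k, finite for d=3 phonons S~k; fails (I ≳ ½log N) under 1-D-type rigidity (Tonks: λ_max~√N) or an incipient solid; no rigorous control of log Ψ₀ at small ρ exists.
sources: Reatto1969, ReattoChester1967, PenroseOnsager1956, GavalakisKontoyiannis2021, DiaconisFreedman1987, Lenard1964
[crux] the card's MI crux in cell-free form: for every repulsive finite-range v, all small ρ, some
C(v,ρ), all large N = n+1, some δ > 0 and EVERY nonneg δ-near-minimiser Ψ (Dirichlet, L =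
(N/ρ)^(1/3)), the mutual information I(x₁ ; (x₂,…,x_N)) = E_Y KL( p(·|Y) ‖ P¹ ) under |Ψ|²dX is ≤ C
(P¹ = one-body law of x₁); typed ∫_Y ∫_(x∈Λ) P¹(x)·m(Y)·klFun( Ψ(x,Y)² / (m(Y)P¹(x)) ) ≤ C. Expected
size O(√(ρa³)) (Bogoliubov/Jastrow heuristic: I ≈ ½·Var of the insertion field ≈ a∫S(k)k⁻²d³k). "One
boson's position carries O(1) nats about all the others" IS condensation for Ψ ≥ 0. [deps: none]
[difficulty: open-problem] [difficulty: open-problem] -/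
@[route_item "route-AtomisticToContinuum-BECConditionalEntropy"]
def MutualInformationBound : Prop :=
  ∀ v : ℝ → ENNReal, Literature.MathematicalPhysics.QuantumManyBody.BoseGas.IsRepulsiveFiniteRange v → ∃ ρ₀ : ℝ, 0 < ρ₀ ∧ ∀ ρ : ℝ, 0 < ρ → ρ < ρ₀ → ∃ C : ℝ, ∀ᶠ n : ℕ in Filter.atTop, ∃ δ : ENNReal, 0 < δ ∧ ∀ Ψ : Literature.MathematicalPhysics.QuantumManyBody.BoseGas.TrialState (n + 1) (Literature.MathematicalPhysics.QuantumManyBody.BoseGas.sideLength ρ (n + 1)), Literature.MathematicalPhysics.QuantumManyBody.BoseGas.energy v Ψ ≤ Literature.MathematicalPhysics.QuantumManyBody.BoseGas.groundStateEnergy v (n + 1) (Literature.MathematicalPhysics.QuantumManyBody.BoseGas.sideLength ρ (n + 1)) + δ → (∀ X, Ψ.ψ X = (‖Ψ.ψ X‖ : ℂ)) → ∫⁻ Y : Literature.MathematicalPhysics.QuantumManyBody.BoseGas.Config n, ∫⁻ x in Literature.MathematicalPhysics.QuantumManyBody.BoseGas.box (Literature.MathematicalPhysics.QuantumManyBody.BoseGas.sideLength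 ρ (n + 1)), ENNReal.ofReal ((∫ Y' : Literature.MathematicalPhysics.QuantumManyBody.BoseGas.Config n, ‖Ψ.ψ (Matrix.vecCons x Y')‖ ^ 2) * (∫ z, ‖Ψ.ψ (Matrix.vecCons z Y)‖ ^ 2) * InformationTheory.klFun (‖Ψ.ψ (Matrix.vecCons x Y)‖ ^ 2 / ((∫ z, ‖Ψ.ψ (Matrix.vecCons z Y)‖ ^ 2) * (∫ Y' : Literature.MathematicalPhysics.QuantumManyBody.BoseGas.Config n, ‖Ψ.ψ (Matrix.vecCons x Y')‖ ^ 2)))) ≤ ENNReal.ofReal C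

/-- item stmt-AtomisticToContinuum-3298 · crux · rank 3 · closed · moot by None · by planner
why it might fail: hard cores v=⊤ are admissible: if the N-sphere configuration space in Λ_L is disconnected mod permutations, or two components tie in energy, the Dirichlet ground space is degenerate and no δ pins the phase; Rellich/Perron–Frobenius for H_N are not in Mathlib.
sources: ReedSimonIV1978, LSSY2005, doi:10.1093/imrn/rnt012, route-AtomisticToContinuum-BECPalmLandscape
[crux] card item A2 (phase rigidity): ∀ admissible v ∃ρ₀ ∀ρ<ρ₀ ∀ᶠ N ∀η>0 ∃δ>0: any two
δ-near-minimisers Ψ, Φ ∈ TrialState N L (L = (N/ρ)^(1/3)) satisfy ∫|Ψ − cΦ|² ≤ η for some unit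
complex c (E₀ < ∞, compact resolvent, unique positive ground state and spectral gap of the Dirichlet
N-body problem at fixed N; for hard cores via connectedness / energetic dominance of the dilute
component of the hard-sphere configuration space). [difficulty: M] -/
@[route_item "route-AtomisticToContinuum-BECConditionalEntropy"]
def GroundStateRigidity : Prop :=
  ∀ v : ℝ → ENNReal, Literature.MathematicalPhysics.QuantumManyBody.BoseGas.IsRepulsiveFiniteRange v → ∃ ρ₀ : ℝ, 0 < ρ₀ ∧ ∀ ρ : ℝ, 0 < ρ → ρ < ρ₀ → ∀ᶠ N : ℕ in Filter.atTop, ∀ η : ℝ, 0 < η → ∃ δ : ENNReal, 0 < δ ∧ ∀ Ψ Φ : Literature.MathematicalPhysics.QuantumManyBody.BoseGas.TrialState N (Literature.MathematicalPhysics.QuantumManyBody.BoseGas.sideLength ρ N), Literature.MathematicalPhysics.QuantumManyBody.BoseGas.energy v Ψ ≤ Literature.MathematicalPhysics.QuantumManyBody.BoseGas.groundStateEnergy v N (Literature.MathematicalPhysics.QuantumManyBody.BoseGas.sideLength ρ N) + δ → Literature.MathematicalPhysics.QuantumManyBody.BoseGas.energy v Φ ≤ Literature.MathematicalPhysics.QuantumManyBody.BoseGas.groundStateEnergy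 v N (Literature.MathematicalPhysics.QuantumManyBody.BoseGas.sideLength ρ N) + δ → ∃ c : ℂ, ‖c‖ = 1 ∧ ∫⁻ X, (‖Ψ.ψ X - c * Φ.ψ X‖₊ : ENNReal) ^ 2 ≤ ENNReal.ofReal η

/-- item stmt-AtomisticToContinuum-3595 · crux · rank 4 · closed · moot by None · by planner
why it might fail: stated for all nonneg δ-near-minimisers in the Dirichlet box (N/ρ)^(1/3): KL(P_l‖ū) ≤ log(sup ρ¹/ρ) grows only under a density pile-up (wall/corner enhancement on a non-vanishing volume fraction); the LY cell superadditivity needs l ≥ aY^(-6/17) and per-cell n_k bookkeeping uniform in N.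
sources: LiebYngvason1998, LSSY2005, Literature.MathematicalPhysics.QuantumManyBody.BoseGas.LSSY2005_boxLowerBound, Literature.MathematicalPhysics.QuantumManyBody.BoseGas.LSSY2005_lowerBound_dirichlet
[crux] NO PILE-UP AT A FIXED SCALE: for every repulsive finite-range v and all small ρ there are a
cell side l > 0 and C such that for all large N = n+1, some δ > 0 and every nonneg δ-near-minimiser
Ψ, the one-body cell law P_l (cells = the ⌈L/l⌉³ congruent half-open sub-cubes of [0,L)³, P_l(k) =
P(x₁ ∈ cell k)) has KL(P_l ‖ uniform) ≤ C; typed Σ_k M⁻³·klFun(M³P_l(k)) ≤ C, M = ⌈L/l⌉. Expected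
proof: Lieb–Yngvason cell method (Neumann box lower bound, LSSY2005 Thm 2.4 / (2.41)–(2.52); in-tree
LSSY2005_boxLowerBound_holds) per cell against a global upper bound gives Σ_k n_k²/|cell| ≤ K'ρN,
i.e. χ²(P_l‖ū) = O(1) ≥ KL, for l ≥ a·Y^(-6/17); the Dirichlet wall layer only depletes. [deps:
none] [difficulty: M] [difficulty: M] -/
@[route_item "route-AtomisticToContinuum-BECConditionalEntropy"]
def ProfileEntropyBound : Prop :=
  ∀ v : ℝ → ENNReal, Literature.MathematicalPhysics.QuantumManyBody.BoseGas.IsRepulsiveFiniteRange v → ∃ ρ₀ : ℝ, 0 < ρ₀ ∧ ∀ ρ : ℝ, 0 < ρ → ρ < ρ₀ → ∃ l : ℝ, 0 < l ∧ ∃ C : ℝ, ∀ᶠ n : ℕ in Filter.atTop, ∃ δ : ENNReal, 0 < δ ∧ ∀ Ψ : Literature.MathematicalPhysics.QuantumManyBody.BoseGas.TrialState (n + 1) (Literature.MathematicalPhysics.QuantumManyBody.BoseGas.sideLength ρ (n + 1)), Literature.MathematicalPhysics.QuantumManyBody.BoseGas.energy v Ψ ≤ Literature.MathematicalPhysics.QuantumManyBody.BoseGas.groundStateEnergy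 v (n + 1) (Literature.MathematicalPhysics.QuantumManyBody.BoseGas.sideLength ρ (n + 1)) + δ → (∀ X, Ψ.ψ X = (‖Ψ.ψ X‖ : ℂ)) → ∑ k : Fin 3 → Fin ⌈Literature.MathematicalPhysics.QuantumManyBody.BoseGas.sideLength ρ (n + 1) / l⌉₊, ((⌈Literature.MathematicalPhysics.QuantumManyBody.BoseGas.sideLength ρ (n + 1) / l⌉₊ : ℝ) ^ 3)⁻¹ * InformationTheory.klFun ((⌈Literature.MathematicalPhysics.QuantumManyBody.BoseGas.sideLength ρ (n + 1) / l⌉₊ : ℝ) ^ 3 * ∫ Y : Literature.MathematicalPhysics.QuantumManyBody.BoseGas.Config n, ∫ x in {y : EuclideanSpace ℝ (Fin 3) | ∀ j, y j ∈ Set.Ico (((k j : ℕ) : ℝ) * (Literature.MathematicalPhysics.QuantumManyBody.BoseGas.sideLength ρ (n + 1) / (⌈Literature.MathematicalPhysics.QuantumManyBody.BoseGas.sideLength ρ (n + 1) / l⌉₊ : ℝ))) ((((k j : ℕ) : ℝ) + 1) * (Literature.MathematicalPhysics.QuantumManyBody.BoseGas.sideLength ρ (n + 1) / (⌈Literature.MathematicalPhysics.QuantumManyBody.BoseGas.sideLength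 ρ (n + 1) / l⌉₊ : ℝ)))}, ‖Ψ.ψ (Matrix.vecCons x Y)‖ ^ 2) ≤ C

/-- item stmt-AtomisticToContinuum-3596 · support · rank 9 · closed · moot by None · by planner
sources: CoverThomas2005, GrunewaldEtAl2009
[support] MutualInformationBound → ProfileEntropyBound → (coarse conditional entropy bound at scale
l: E_Y KL(Q_l(·|Y) ‖ ū_l) ≤ C, Q_l(k|Y) = P(x₁ ∈ cell k | Y), typed ∫_Y Σ_k
m(Y)M⁻³klFun(M³A_k(Y)/m(Y))). Exact identity E_Y KL(Q_l(·|Y)‖ū_l) = I(cell_l(x₁);Y) + KL(P_l‖ū_l)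
and data processing I(cell_l(x₁);Y) ≤ I(x₁;Y) (log-sum / Jensen for klFun); constants add, δ := min,
ρ₀ := min. [deps: MutualInformationBound, ProfileEntropyBound] [difficulty: provable-now; Lean:
Fubini on Config n × Λ, finite sums, log-sum inequality] [difficulty: provable-now] -/
@[route_item "route-AtomisticToContinuum-BECConditionalEntropy"]
def CoarseFromMIProfile : Prop :=
  MutualInformationBound → ProfileEntropyBound → (∀ v : ℝ → ENNReal, Literature.MathematicalPhysics.QuantumManyBody.BoseGas.IsRepulsiveFiniteRange v → ∃ ρ₀ : ℝ, 0 < ρ₀ ∧ ∀ ρ : ℝ, 0 < ρ → ρ < ρ₀ → ∃ l : ℝ, 0 < l ∧ ∃ C : ℝ, ∀ᶠ n : ℕ in Filter.atTop, ∃ δ : ENNReal, 0 < δ ∧ ∀ Ψ : Literature.MathematicalPhysics.QuantumManyBody.BoseGas.TrialState (n + 1) (Literature.MathematicalPhysics.QuantumManyBody.BoseGas.sideLength ρ (n + 1)), Literature.MathematicalPhysics.QuantumManyBody.BoseGas.energy v Ψ ≤ Literature.MathematicalPhysics.QuantumManyBody.BoseGas.groundStateEnergy v (n + 1) (Literature.MathematicalPhysics.QuantumManyBody.BoseGas.sideLength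 ρ (n + 1)) + δ → (∀ X, Ψ.ψ X = (‖Ψ.ψ X‖ : ℂ)) → ∫⁻ Y : Literature.MathematicalPhysics.QuantumManyBody.BoseGas.Config n, ENNReal.ofReal (∑ k : Fin 3 → Fin ⌈Literature.MathematicalPhysics.QuantumManyBody.BoseGas.sideLength ρ (n + 1) / l⌉₊, (∫ z, ‖Ψ.ψ (Matrix.vecCons z Y)‖ ^ 2) / (⌈Literature.MathematicalPhysics.QuantumManyBody.BoseGas.sideLength ρ (n + 1) / l⌉₊ : ℝ) ^ 3 * InformationTheory.klFun ((⌈Literature.MathematicalPhysics.QuantumManyBody.BoseGas.sideLength ρ (n + 1) / l⌉₊ : ℝ) ^ 3 * (∫ x in {y : EuclideanSpace ℝ (Fin 3) | ∀ j, y j ∈ Set.Ico (((k j : ℕ) : ℝ) * (Literature.MathematicalPhysics.QuantumManyBody.BoseGas.sideLength ρ (n + 1) / (⌈Literature.MathematicalPhysics.QuantumManyBody.BoseGas.sideLength ρ (n + 1) / l⌉₊ : ℝ))) ((((k j : ℕ) : ℝ) + 1) * (Literature.MathematicalPhysics.QuantumManyBody.BoseGas.sideLength ρ (n + 1) / (⌈Literature.MathematicalPhysics.QuantumManyBody.BoseGas.sideLength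 ρ (n + 1) / l⌉₊ : ℝ)))}, ‖Ψ.ψ (Matrix.vecCons x Y)‖ ^ 2) / ∫ z, ‖Ψ.ψ (Matrix.vecCons z Y)‖ ^ 2)) ≤ ENNReal.ofReal C)

/-- item stmt-AtomisticToContinuum-3597 · support · rank 9 · closed · moot by None · by planner
sources: Weissler1980, Ledoux2001, GrunewaldEtAl2009, LSSY2005
[support] EnergyPerParticleBound → (coarse bound at scale l) → CondEntropyBound. Exact KL chain rule
over the cell partition, KL(p‖u) = KL(Q_l‖ū_l) + Σ_k Q_l(k)KL(p_k‖u_k); local term Σ_k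
Q_l(k)KL(p_k‖u_k) ≤ c₀(L/M)²∫_Λ|∇_x√p|²dx with √p = Ψ(·,Y)/√m(Y) (Ψ ≥ 0 is C¹; no square root of Ψ
is taken) by the logarithmic Sobolev inequality for Lebesgue measure on a cube of side s with
constant c₀s² (Weissler1980 circle LSI + even reflection + tensorisation); its E_Y is c₀(L/M)² ×
(kinetic energy of particle 1) = c₀(L/M)²·T(Ψ)/N ≤ c₀l²(K + δ/N) by Bose symmetry and T ≤ energy ≤
E₀ + δ ≤ KN + δ. [deps: EnergyPerParticleBound] [difficulty: L in Lean (cube LSI is not in Mathlib);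
a theorem mathematically] [difficulty: L] -/
@[route_item "route-AtomisticToContinuum-BECConditionalEntropy"]
def TwoScaleReduction : Prop :=
  (∀ v : ℝ → ENNReal, Literature.MathematicalPhysics.QuantumManyBody.BoseGas.IsRepulsiveFiniteRange v → ∃ ρ₀ : ℝ, 0 < ρ₀ ∧ ∀ ρ : ℝ, 0 < ρ → ρ < ρ₀ → ∃ K : ℝ, ∀ᶠ N : ℕ in Filter.atTop, Literature.MathematicalPhysics.QuantumManyBody.BoseGas.groundStateEnergy v N (Literature.MathematicalPhysics.QuantumManyBody.BoseGas.sideLength ρ N) ≤ ENNReal.ofReal (K * N)) → (∀ v : ℝ → ENNReal, Literature.MathematicalPhysics.QuantumManyBody.BoseGas.IsRepulsiveFiniteRange v → ∃ ρ₀ : ℝ, 0 < ρ₀ ∧ ∀ ρ : ℝ, 0 < ρ → ρ < ρ₀ → ∃ l : ℝ, 0 < l ∧ ∃ C : ℝ, ∀ᶠ n : ℕ in Filter.atTop, ∃ δ : ENNReal, 0 < δ ∧ ∀ Ψ : Literature.MathematicalPhysics.QuantumManyBody.BoseGas.TrialState (n + 1) (Literature.MathematicalPhysics.QuantumManyBody.BoseGas.sideLength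 ρ (n + 1)), Literature.MathematicalPhysics.QuantumManyBody.BoseGas.energy v Ψ ≤ Literature.MathematicalPhysics.QuantumManyBody.BoseGas.groundStateEnergy v (n + 1) (Literature.MathematicalPhysics.QuantumManyBody.BoseGas.sideLength ρ (n + 1)) + δ → (∀ X, Ψ.ψ X = (‖Ψ.ψ X‖ : ℂ)) → ∫⁻ Y : Literature.MathematicalPhysics.QuantumManyBody.BoseGas.Config n, ENNReal.ofReal (∑ k : Fin 3 → Fin ⌈Literature.MathematicalPhysics.QuantumManyBody.BoseGas.sideLength ρ (n + 1) / l⌉₊, (∫ z, ‖Ψ.ψ (Matrix.vecCons z Y)‖ ^ 2) / (⌈Literature.MathematicalPhysics.QuantumManyBody.BoseGas.sideLength ρ (n + 1) / l⌉₊ : ℝ) ^ 3 * InformationTheory.klFun ((⌈Literature.MathematicalPhysics.QuantumManyBody.BoseGas.sideLength ρ (n + 1) / l⌉₊ : ℝ) ^ 3 * (∫ x in {y : EuclideanSpace ℝ (Fin 3) | ∀ j, y j ∈ Set.Ico (((k j : ℕ) : ℝ) * (Literature.MathematicalPhysics.QuantumManyBody.BoseGas.sideLength ρ (n + 1) / (⌈Literature.MathematicalPhysics.QuantumManyBody.BoseGas.sideLength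 ρ (n + 1) / l⌉₊ : ℝ))) ((((k j : ℕ) : ℝ) + 1) * (Literature.MathematicalPhysics.QuantumManyBody.BoseGas.sideLength ρ (n + 1) / (⌈Literature.MathematicalPhysics.QuantumManyBody.BoseGas.sideLength ρ (n + 1) / l⌉₊ : ℝ)))}, ‖Ψ.ψ (Matrix.vecCons x Y)‖ ^ 2) / ∫ z, ‖Ψ.ψ (Matrix.vecCons z Y)‖ ^ 2)) ≤ ENNReal.ofReal C) → (∀ v : ℝ → ENNReal, Literature.MathematicalPhysics.QuantumManyBody.BoseGas.IsRepulsiveFiniteRange v → ∃ ρ₀ : ℝ, 0 < ρ₀ ∧ ∀ ρ : ℝ, 0 < ρ → ρ < ρ₀ → ∃ C : ℝ, ∀ᶠ n : ℕ in Filter.atTop, ∃ δ : ENNReal, 0 < δ ∧ ∀ Ψ : Literature.MathematicalPhysics.QuantumManyBody.BoseGas.TrialState (n + 1) (Literature.MathematicalPhysics.QuantumManyBody.BoseGas.sideLength ρ (n + 1)), Literature.MathematicalPhysics.QuantumManyBody.BoseGas.energy v Ψ ≤ Literature.MathematicalPhysics.QuantumManyBody.BoseGas.groundStateEnergy v (n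 + 1) (Literature.MathematicalPhysics.QuantumManyBody.BoseGas.sideLength ρ (n + 1)) + δ → (∀ X, Ψ.ψ X = (‖Ψ.ψ X‖ : ℂ)) → ∫⁻ Y : Literature.MathematicalPhysics.QuantumManyBody.BoseGas.Config n, ∫⁻ x in Literature.MathematicalPhysics.QuantumManyBody.BoseGas.box (Literature.MathematicalPhysics.QuantumManyBody.BoseGas.sideLength ρ (n + 1)), ENNReal.ofReal ((∫ z, ‖Ψ.ψ (Matrix.vecCons z Y)‖ ^ 2) / Literature.MathematicalPhysics.QuantumManyBody.BoseGas.sideLength ρ (n + 1) ^ 3 * InformationTheory.klFun (Literature.MathematicalPhysics.QuantumManyBody.BoseGas.sideLength ρ (n + 1) ^ 3 * ‖Ψ.ψ (Matrix.vecCons x Y)‖ ^ 2 / ∫ z, ‖Ψ.ψ (Matrix.vecCons z Y)‖ ^ 2)) ≤ ENNReal.ofReal C)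

/-- item stmt-AtomisticToContinuum-3598 · support · rank 9 · closed · moot by None · by planner
sources: Reatto1969, PenroseOnsager1956, LSSY2005, CoverThomas2005
[support] CondEntropyBound → (zero-mode occupation ≥ cN for NONNEG near-minimisers). The Rényi-½
identity: for Ψ ≥ 0, ⟨φ₀,γ_Ψφ₀⟩/N = L⁻³∫(∫Ψ(x,Y)dx)²dY = E_Y exp(−D_½(p(·|Y)‖u_Λ)); Jensen (m(Y)dY
is a probability law) and D_½ ≤ KL (= ∫u·klFun(p/u) here) give ⟨φ₀,γφ₀⟩ ≥ exp(−C)·N; index shift N =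
n+1 under ∀ᶠ. Same algebra as BECPalmLandscape.FlatModeFromLandscape with log in place of
Cauchy–Schwarz. [deps: CondEntropyBound] [difficulty: provable-now (Jensen for −log on a probability
density over Config n; occupation unfolds by definition)] [difficulty: provable-now] -/
@[route_item "route-AtomisticToContinuum-BECConditionalEntropy"]
def EntropicZeroMode : Prop :=
  (∀ v : ℝ → ENNReal, Literature.MathematicalPhysics.QuantumManyBody.BoseGas.IsRepulsiveFiniteRange v → ∃ ρ₀ : ℝ, 0 < ρ₀ ∧ ∀ ρ : ℝ, 0 < ρ → ρ < ρ₀ → ∃ C : ℝ, ∀ᶠ n : ℕ in Filter.atTop, ∃ δ : ENNReal, 0 < δ ∧ ∀ Ψ : Literature.MathematicalPhysics.QuantumManyBody.BoseGas.TrialState (n + 1) (Literature.MathematicalPhysics.QuantumManyBody.BoseGas.sideLength ρ (n + 1)), Literature.MathematicalPhysics.QuantumManyBody.BoseGas.energy v Ψ ≤ Literature.MathematicalPhysics.QuantumManyBody.BoseGas.groundStateEnergy v (n + 1) (Literature.MathematicalPhysics.QuantumManyBody.BoseGas.sideLength ρ (n + 1)) + δ → (∀ X, Ψ.ψ X = (‖Ψ.ψ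 X‖ : ℂ)) → ∫⁻ Y : Literature.MathematicalPhysics.QuantumManyBody.BoseGas.Config n, ∫⁻ x in Literature.MathematicalPhysics.QuantumManyBody.BoseGas.box (Literature.MathematicalPhysics.QuantumManyBody.BoseGas.sideLength ρ (n + 1)), ENNReal.ofReal ((∫ z, ‖Ψ.ψ (Matrix.vecCons z Y)‖ ^ 2) / Literature.MathematicalPhysics.QuantumManyBody.BoseGas.sideLength ρ (n + 1) ^ 3 * InformationTheory.klFun (Literature.MathematicalPhysics.QuantumManyBody.BoseGas.sideLength ρ (n + 1) ^ 3 * ‖Ψ.ψ (Matrix.vecCons x Y)‖ ^ 2 / ∫ z, ‖Ψ.ψ (Matrix.vecCons z Y)‖ ^ 2)) ≤ ENNReal.ofReal C) → (∀ v : ℝ → ENNReal, Literature.MathematicalPhysics.QuantumManyBody.BoseGas.IsRepulsiveFiniteRange v → ∃ ρ₀ : ℝ, 0 < ρ₀ ∧ ∀ ρ : ℝ, 0 < ρ → ρ < ρ₀ → ∃ c : ℝ, 0 < c ∧ ∀ᶠ N : ℕ in Filter.atTop, ∃ δ : ENNReal, 0 < δ ∧ ∀ Ψ : Literature.MathematicalPhysics.QuantumManyBody.BoseGas.TrialState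 N (Literature.MathematicalPhysics.QuantumManyBody.BoseGas.sideLength ρ N), Literature.MathematicalPhysics.QuantumManyBody.BoseGas.energy v Ψ ≤ Literature.MathematicalPhysics.QuantumManyBody.BoseGas.groundStateEnergy v N (Literature.MathematicalPhysics.QuantumManyBody.BoseGas.sideLength ρ N) + δ → (∀ X, Ψ.ψ X = (‖Ψ.ψ X‖ : ℂ)) → ENNReal.ofReal (c * N) ≤ Literature.MathematicalPhysics.QuantumManyBody.BoseGas.occupation N ((Literature.MathematicalPhysics.QuantumManyBody.BoseGas.box (Literature.MathematicalPhysics.QuantumManyBody.BoseGas.sideLength ρ N)).indicator fun _ => ((Real.sqrt (Literature.MathematicalPhysics.QuantumManyBody.BoseGas.sideLength ρ N ^ 3))⁻¹ : ℂ)) Ψ.ψ)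

/-- item stmt-AtomisticToContinuum-3599 · support · rank 9 · closed · moot by None · by planner
sources: LSSY2005, ReedSimonIV1978, PenroseOnsager1956
[support] EnergyPerParticleBound → GroundStateRigidity → (zero-mode bound for nonneg
near-minimisers) → X_B1 (conclusion = BECInfraredBound.BecZeroModeThesis verbatim, rfl-checked in
Sketch.lean, so that bec_of_zeroMode applies). Proof: E₀ ≤ KN < ∞ gives, for every δ, a
near-minimiser, and diamagnetic smoothing f_ε = √(|Ψ|²+ε²) − ε (C¹, vanishes off Λ^N, symmetric,
|∇f_ε| ≤ |∇Ψ|, f_ε ≤ |Ψ|), normalised, is a NONNEG δ-near-minimiser Φ; it has ⟨φ₀,γφ₀⟩ ≥ cN;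
rigidity with η = c/4 gives ‖Ψ − c'Φ‖₂² ≤ η for every δ-near-minimiser Ψ; √occupation is
√N-Lipschitz in L² (BECPalmLandscape.OccupationStability), so ⟨φ₀,γ_Ψφ₀⟩ ≥ cN/4. [deps:
EnergyPerParticleBound, GroundStateRigidity] [difficulty: provable-now, M in Lean (the smoothed
TrialState)] [difficulty: provable-now] -/
@[route_item "route-AtomisticToContinuum-BECConditionalEntropy"]
def RigidityTransfersZeroMode : Prop :=
  (∀ v : ℝ → ENNReal, Literature.MathematicalPhysics.QuantumManyBody.BoseGas.IsRepulsiveFiniteRange v → ∃ ρ₀ : ℝ, 0 < ρ₀ ∧ ∀ ρ : ℝ, 0 < ρ → ρ < ρ₀ → ∃ K : ℝ, ∀ᶠ N : ℕ in Filter.atTop, Literature.MathematicalPhysics.QuantumManyBody.BoseGas.groundStateEnergy v N (Literature.MathematicalPhysics.QuantumManyBody.BoseGas.sideLength ρ N) ≤ ENNReal.ofReal (K * N)) → (∀ v : ℝ → ENNReal, Literature.MathematicalPhysics.QuantumManyBody.BoseGas.IsRepulsiveFiniteRange v → ∃ ρ₀ : ℝ, 0 < ρ₀ ∧ ∀ ρ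 : ℝ, 0 < ρ → ρ < ρ₀ → ∀ᶠ N : ℕ in Filter.atTop, ∀ η : ℝ, 0 < η → ∃ δ : ENNReal, 0 < δ ∧ ∀ Ψ Φ : Literature.MathematicalPhysics.QuantumManyBody.BoseGas.TrialState N (Literature.MathematicalPhysics.QuantumManyBody.BoseGas.sideLength ρ N), Literature.MathematicalPhysics.QuantumManyBody.BoseGas.energy v Ψ ≤ Literature.MathematicalPhysics.QuantumManyBody.BoseGas.groundStateEnergy v N (Literature.MathematicalPhysics.QuantumManyBody.BoseGas.sideLength ρ N) + δ → Literature.MathematicalPhysics.QuantumManyBody.BoseGas.energy v Φ ≤ Literature.MathematicalPhysics.QuantumManyBody.BoseGas.groundStateEnergy v N (Literature.MathematicalPhysics.QuantumManyBody.BoseGas.sideLength ρ N) + δ → ∃ c : ℂ, ‖c‖ = 1 ∧ ∫⁻ X, (‖Ψ.ψ X - c * Φ.ψ X‖₊ : ENNReal) ^ 2 ≤ ENNReal.ofReal η) → (∀ v : ℝ → ENNReal, Literature.MathematicalPhysics.QuantumManyBody.BoseGas.IsRepulsiveFiniteRange v → ∃ ρ₀ : ℝ, 0 < ρ₀ ∧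 ∀ ρ : ℝ, 0 < ρ → ρ < ρ₀ → ∃ c : ℝ, 0 < c ∧ ∀ᶠ N : ℕ in Filter.atTop, ∃ δ : ENNReal, 0 < δ ∧ ∀ Ψ : Literature.MathematicalPhysics.QuantumManyBody.BoseGas.TrialState N (Literature.MathematicalPhysics.QuantumManyBody.BoseGas.sideLength ρ N), Literature.MathematicalPhysics.QuantumManyBody.BoseGas.energy v Ψ ≤ Literature.MathematicalPhysics.QuantumManyBody.BoseGas.groundStateEnergy v N (Literature.MathematicalPhysics.QuantumManyBody.BoseGas.sideLength ρ N) + δ → (∀ X, Ψ.ψ X = (‖Ψ.ψ X‖ : ℂ)) → ENNReal.ofReal (c * N) ≤ Literature.MathematicalPhysics.QuantumManyBody.BoseGas.occupation N ((Literature.MathematicalPhysics.QuantumManyBody.BoseGas.box (Literature.MathematicalPhysics.QuantumManyBody.BoseGas.sideLength ρ N)).indicator fun _ => ((Real.sqrt (Literature.MathematicalPhysics.QuantumManyBody.BoseGas.sideLength ρ N ^ 3))⁻¹ : ℂ)) Ψ.ψ) → (∀ v : ℝ → ENNReal, Literature.MathematicalPhysics.QuantumManyBody.BoseGas.IsRepulsiveFiniteRange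 v → ∃ ρ₀ : ℝ, 0 < ρ₀ ∧ ∀ ρ : ℝ, 0 < ρ → ρ < ρ₀ → ∃ c : ℝ, 0 < c ∧ ∀ᶠ N : ℕ in Filter.atTop, ∃ δ : ENNReal, 0 < δ ∧ ∀ Ψ : Literature.MathematicalPhysics.QuantumManyBody.BoseGas.TrialState N (Literature.MathematicalPhysics.QuantumManyBody.BoseGas.sideLength ρ N), Literature.MathematicalPhysics.QuantumManyBody.BoseGas.energy v Ψ ≤ Literature.MathematicalPhysics.QuantumManyBody.BoseGas.groundStateEnergy v N (Literature.MathematicalPhysics.QuantumManyBody.BoseGas.sideLength ρ N) + δ → ENNReal.ofReal (c * N) ≤ Literature.MathematicalPhysics.QuantumManyBody.BoseGas.occupation N ((Literature.MathematicalPhysics.QuantumManyBody.BoseGas.box (Literature.MathematicalPhysics.QuantumManyBody.BoseGas.sideLength ρ N)).indicator fun _ => ((Real.sqrt (Literature.MathematicalPhysics.QuantumManyBody.BoseGas.sideLength ρ N ^ 3))⁻¹ : ℂ)) Ψ.ψ)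

/-- item stmt-AtomisticToContinuum-3600 · support · rank 9 · closed · moot by None · by planner
sources: LSSY2005, Dyson1957
[support] energy per particle bounded in the thermodynamic limit at small density: for every
repulsive finite-range v (range R₀) there is ρ₀ > 0 (any ρ₀ < (8R₀³)⁻¹ works) such that for 0 < ρ <
ρ₀ there is K with E₀(N,(N/ρ)^(1/3)) ≤ K·N for all large N. Proof: symmetrised product of N
disjointly supported C¹ bumps of radius ρ^(-1/3)/4 centred in the N sub-cubes of side ρ^(-1/3)
(pairwise support distance > R₀ ⇒ interaction 0, ⊤·0 = 0; energy = N × one bump ≈ 16C·ρ^(2/3)·N).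
Only boundedness is used downstream (the sharp 4πρa(1+o(1)) of LSSY2005 Thm 2.2 is not needed); also
the E₀ < ∞ input of the rigidity transfer. [difficulty: provable-now, pattern of
TrialState.nonempty_one] [difficulty: provable-now] -/
@[route_item "route-AtomisticToContinuum-BECConditionalEntropy"]
def EnergyPerParticleBound : Prop :=
  ∀ v : ℝ → ENNReal, Literature.MathematicalPhysics.QuantumManyBody.BoseGas.IsRepulsiveFiniteRange v → ∃ ρ₀ : ℝ, 0 < ρ₀ ∧ ∀ ρ : ℝ, 0 < ρ → ρ < ρ₀ → ∃ K : ℝ, ∀ᶠ N : ℕ in Filter.atTop, Literature.MathematicalPhysics.QuantumManyBody.BoseGas.groundStateEnergy v N (Literature.MathematicalPhysics.QuantumManyBody.BoseGas.sideLength ρ N) ≤ ENNReal.ofReal (K * N)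

/-- item stmt-AtomisticToContinuum-3601 · assembly · rank 1 · closed · moot by None · by planner
sources: LSSY2005, PenroseOnsager1956
[assembly] MutualInformationBound → ProfileEntropyBound → CoarseFromMIProfile →
EnergyPerParticleBound → TwoScaleReduction → EntropicZeroMode → GroundStateRigidity →
RigidityTransfersZeroMode → BoseEinsteinCondensation. -/
@[route_item "route-AtomisticToContinuum-BECConditionalEntropy"]
def Assembly : Prop :=
  MutualInformationBound → ProfileEntropyBound → CoarseFromMIProfile → EnergyPerParticleBound → TwoScaleReduction → EntropicZeroMode → GroundStateRigidity → RigidityTransfersZeroMode → Literature.MathematicalPhysics.QuantumManyBody.BoseGas.BoseEinsteinCondensation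

end Summit.AtomisticToContinuum.BoseEinsteinCondensation.Theses.BECConditionalEntropy
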